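import Mathlib
import Summits.NavierStokesRegularity.NavierStokesRegularity.Theorems.DssFarFieldSlavingBlowupTypeIDssProfileGaussianSignCoherentClass
import Summits.NavierStokesRegularity.NavierStokesRegularity.Theorems.DssFarFieldSlavingBlowupTypeIDssProfileRigidRotation
import Summits.NavierStokesRegularity.NavierStokesRegularity.Theorems.DssFarFieldSlavingBlowupTypeIDssProfileFiniteOrderTwist
import Summits.NavierStokesRegularity.NavierStokesRegularity.Theorems.DssFarFieldSlavingBlowupTypeIDssProfileTwistNormalForm
import HarnessLib

/-!
# E33 (pointwise) and E33-MEAN are EMPTY at CLASS level for EVERY twist `R ∈ O(3)` (pub-ns-dss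
  theory T42 / row E33, E33-CLASS-BRIDGE v1.2 (C2)–(C4) and l.10 «general R ∈ O(3): conjugation +
  (c², R²)», NULL-TESTS n21; route `DssFarFieldSlaving`, crux `BlowupTypeIDssProfile`,
  stmt-NavierStokesRegularity-0155 — SUPPORT; cell pub-ns-dss, typer seat g6, 2026-08-23; imports
  the `e₃`-axis class file `…GaussianSignCoherentClass.lean` and the bookkeeping file
  `…TwistNormalForm.lean`)

HONEST FRAMING. Liouville statements for SLICES of the hypothesis class of
`Theses.FilamentSkeletonRss.RdssProfileTruncation` (H0 `1 < c`, H5 ancient mild `ν = 1`, H4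
measurable slices, H2 rotated `c`-DSS — HERE WITH AN ARBITRARY TWIST `R ∈ O(3)`, any linear isometry
of `ℝ³` — H3 `HasTypeIDecay M u`, H6 non-trivial) cut by a SIGN CONDITION; conditional theorems
about hypothetical profiles, verified for no candidate; an empty slice is a census ghost index, never
a discard; nothing here is numerical and nothing here bears on Navier–Stokes regularity or blow-up.

WHAT IS NEW. The landed `e₃`-axis theorems (`rdssClass_signCoherent_empty`, `rdssClass_meanSignCoherent_empty`,
twist `rotZLIE (−θ)`) carried the label «e₃-axis twist; general `R ∈ O(3)` derivable, not typed». Typed here, BOOKKEEPING ONLY: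
(1) the member is `(c², R²)`-RDSS (`isRotatedDSS_mul`); (2) `R²` has determinant `1`, so by Euler's
rotation theorem `R² = P R_θ P⁻¹` for a linear isometry `P` (`TwistNormalForm.exists_trans_self_eq_conj_rotZLIE`);
(3) the conjugate `P⁻¹ V P` of the KNSS representative is a KNSS-gauge Type-I `(c², R_θ)`-RDSS field
(class covariance: `isTypeIAncientMild_conj_linearIsometryEquiv`, `hasTypeIDecay_conj`,
`isRotatedDSS_conj`) whose Calderón–Zygmund pressure is `Q[V(t)] ∘ P`
(`TwistNormalForm.pressurePotential_conj`); (4) the `e₃`-axis theorems apply at factor `c²`.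

THE HYPOTHESES ARE STATED FRAME-FREE (no co-rotating frame exists for a general screw axis until one
conjugates; the frame is bookkeeping, not content):
* POINTWISE cell, physical variables: `0 ≤ ⟪x, V(t,x)⟫ (½|V(t,x)|² + Q[V(t)](x))` for all `t < 0`, `x`,
  `Q = pressurePotential` (Tao 2011 (35)) — point by point the same condition as the co-rotating
  similarity form of the `e₃` files (`TwistNormalForm.inner_lerayOrbit_mul_eq`: the two sign
  quantities differ by the factor `e^{−s} > 0`). GAUGE NAMED: not invariant under `p ↦ p + c(t)`.
* MEAN cell (NULL-TESTS n21), similarity variables WITHOUT frame rotation: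
  `0 ≤ ∫₀^{2 log c} ∫ γ(y) ⟪y,U⟫(½|U|² + P + ½⟪y,U⟫) dy ds`, `U = lerayOrbit V s`,
  `P(y,s) = e^{−s} Q[V(−e^{−s})](e^{−s/2} y)`, ONE period `2 log c` for every `R` — the co-rotating
  frame of the `e₃` files drops out of the Gaussian pairing slice by slice
  (`integral_gaussPairing_corot_conj`), and the two-period window produced by step (1) is reduced to
  one period by the `2 log c`-PERIODICITY of the frame-free pairing of an RDSS field
  (`integral_gaussPairing_add_period`, `intervalIntegral_nonneg_two_periods`). Gauge invariant.
LABELS (lead's words, on acceptance): E33 POINTWISE / E33-MEAN cells EMPTY at CLASS level for «any twist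
R ∈ O(3)». [this file; theory T42/E33 + E33-CLASS-BRIDGE l.10]
-/

noncomputable section

set_option linter.dupNamespace false

namespace Summit.NavierStokesRegularity.NavierStokesRegularity.Theorems.GaussianHeadPressure

open Set Function Filter MeasureTheory InnerProductSpace Metric
open scoped RealInnerProductSpace Topology BigOperators
open Literature.Analysis Literature.Analysis.FluidPDE Literature.Analysis.FluidPDE.PineauVicol2026
open Summit.NavierStokesRegularity.NavierStokesRegularity.Theorems
open Summit.NavierStokesRegularity.NavierStokesRegularity.Theorems.TwistNormalForm

/-! ### Conjugating a KNSS-gauge Type-I rotated-DSS field into `e₃`-twist normal form -/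

/-- The conjugate `P⁻¹ V P` of a KNSS-gauge Type-I field is a KNSS-gauge Type-I field (same
constant). [folklore] -/
theorem isTypeIAncientMild_conj_symm {M : ℝ}
    {V : ℝ → EuclideanSpace ℝ (Fin 3) → EuclideanSpace ℝ (Fin 3)} (hT : IsTypeIAncientMild M V)
    (P : EuclideanSpace ℝ (Fin 3) ≃ₗᵢ[ℝ] EuclideanSpace ℝ (Fin 3)) : IsTypeIAncientMild M
        (fun t x => P.symm (V t (P x))) := by
  simpa only [LinearIsometryEquiv.symm_symm] using
    SymmetryModuliCountSymmetricLiouville.isTypeIAncientMild_conj_linearIsometryEquiv hT P.symm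

/-- The conjugate `P⁻¹ V P` of a field with the Type-I space–time bound has the same bound. [folklore] -/
theorem hasTypeIDecay_conj_symm {M : ℝ}
    {V : ℝ → EuclideanSpace ℝ (Fin 3) → EuclideanSpace ℝ (Fin 3)} (hdec : HasTypeIDecay M V)
    (P : EuclideanSpace ℝ (Fin 3) ≃ₗᵢ[ℝ] EuclideanSpace ℝ (Fin 3)) : HasTypeIDecay M
        (fun t x => P.symm (V t (P x))) := by
  simpa only [LinearIsometryEquiv.symm_symm] using RigidRotation.hasTypeIDecay_conj hdec P.symm

/-- If `u` is `(c, N)`-rotated-DSS with `N = P R_θ P⁻¹` (`R_θ = rotZLIE θ`), then the conjugate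
`P⁻¹ u P` is `(c, R_θ)`-rotated-DSS, i.e. `(c, rotZLIE (−θ'))` with `θ' = −θ` (the Pineau–Vicol
spelling used by the `e₃`-axis theorems). [folklore] -/
theorem isRotatedDSS_conj_symm_of_eq_conj {c θ : ℝ}
    {N P : EuclideanSpace ℝ (Fin 3) ≃ₗᵢ[ℝ] EuclideanSpace ℝ (Fin 3)}
    {u : ℝ → EuclideanSpace ℝ (Fin 3) → EuclideanSpace ℝ (Fin 3)}
    (h : IsRotatedDSS c N u) (hN : N = (P.symm.trans (rotZLIE θ)).trans P) :
    IsRotatedDSS c (rotZLIE (-(-θ))) (fun t x => P.symm (u t (P x))) := by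
  have h1 := RigidRotation.isRotatedDSS_conj h P.symm
  have e : (P.symm.symm.trans N).trans P.symm = rotZLIE (-(-θ)) := by
    rw [neg_neg, hN]
    apply LinearIsometryEquiv.ext
    intro x
    simp only [LinearIsometryEquiv.symm_symm, LinearIsometryEquiv.trans_apply,
      LinearIsometryEquiv.symm_apply_apply]
  rw [e] at h1
  simpa only [LinearIsometryEquiv.symm_symm] using h1

/-! ### E33 POINTWISE for a general twist `R ∈ O(3)` — CLASSICAL level -/

/-- **E33 (pointwise form), CLASSICAL level, GENERAL TWIST.** Let `V` be a Type-I ancient mild field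
in the KNSS gauge (`IsTypeIAncientMild M V`) with the space–time Type-I bound `HasTypeIDecay M V`,
rotated `c`-DSS with an ARBITRARY twist `R ∈ O(3)` (`IsRotatedDSS c R V`, `R` any linear isometry of
`ℝ³`, `1 < c`). If the sign condition holds POINTWISE IN PHYSICAL VARIABLES with the Calderón–Zygmund
pressure `Q[V(t)] = pressurePotential (V t)` (Tao 2011 (35); GAUGE NAMED — the hypothesis is not
invariant under adding a function of `t` to the pressure):
`0 ≤ ⟪x, V(t,x)⟫ (½|V(t,x)|² + Q[V(t)](x))` for all `t < 0`, `x`, then `V ≡ 0` on `t < 0`.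
This is the frame-free form of the hypothesis of `typeI_rdss_signCoherent_eq_zero` (the two agree
point by point: `⟪y,U⟫(½|U|² + P) = e^{−s}·⟪x,V⟫(½|V|² + Q[V(t)](x))` at `t = −e^{−s}`,
`x = e^{−s/2} R_{αs} y`, `TwistNormalForm.inner_lerayOrbit_mul_eq`). PROOF (bookkeeping only): `V` is
`(c², R²)`-RDSS (`isRotatedDSS_mul`); `R² = P R_θ P⁻¹` (Euler's rotation theorem,
`TwistNormalForm.exists_trans_self_eq_conj_rotZLIE`); the conjugate `P⁻¹ V P` is a KNSS-gauge Type-I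
`(c², R_θ)`-RDSS field (class covariance), its Calderón–Zygmund pressure is `Q[V(t)] ∘ P`
(`TwistNormalForm.pressurePotential_conj_symm`), so it satisfies the co-rotating hypothesis of the
`e₃`-axis theorem `typeI_rdss_signCoherent_eq_zero` at factor `c²`, which gives `P⁻¹ V P ≡ 0`.
[this file; theory T42/E33 + E33-CLASS-BRIDGE v1.2 (C2)–(C4) and l.10 (general `R ∈ O(3)`:
conjugation + `(c², R²)`), classical level] -/
theorem typeI_rdss_signCoherent_eq_zero_of_twist {M c : ℝ}
    {R : EuclideanSpace ℝ (Fin 3) ≃ₗᵢ[ℝ] EuclideanSpace ℝ (Fin 3)}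
    {V : ℝ → EuclideanSpace ℝ (Fin 3) → EuclideanSpace ℝ (Fin 3)} (hc : 1 < c)
    (hT : IsTypeIAncientMild M V) (hR : IsRotatedDSS c R V) (hVdec : HasTypeIDecay M V)
    (hsV : ∀ t < 0, ∀ x : EuclideanSpace ℝ (Fin 3), 0 ≤ ⟪x, V t x⟫ *
        (2⁻¹ * ‖V t x‖ ^ 2 + pressurePotential (V t) x)) :
    ∀ t < 0, ∀ x, V t x = 0 := by
  have hR2 : IsRotatedDSS (c * c) (R * R) V := isRotatedDSS_mul hR hR
  obtain ⟨P, θ, hPθ⟩ := exists_trans_self_eq_conj_rotZLIE R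
  have hcc : 1 < c * c := by nlinarith
  have hTW := isTypeIAncientMild_conj_symm hT P
  have hWdec := hasTypeIDecay_conj_symm hVdec P
  have hRW := isRotatedDSS_conj_symm_of_eq_conj hR2 hPθ
  have hz := typeI_rdss_signCoherent_eq_zero hcc hTW hRW hWdec (by
    intro s y
    rw [inner_rotZ_neg, norm_rotZ, lerayOrbit_conj_symm, inner_symm_right,
        LinearIsometryEquiv.norm_map,
      pressurePotential_conj_symm, map_smul, inner_lerayOrbit_mul_eq]
    exact mul_nonneg (Real.exp_pos _).le (hsV _ (neg_neg_of_pos (Real.exp_pos _)) _))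
  intro t ht x
  have h := hz t ht (P.symm x)
  simp only [LinearIsometryEquiv.apply_symm_apply, LinearIsometryEquiv.map_eq_zero_iff] at h
  exact h

/-! ### E33 POINTWISE for a general twist — CLASS level -/

/-- **E33 (pointwise form) at CLASS level, GENERAL TWIST — Liouville form.** Let `u` be an ancient
mild solution (`ν = 1`) with measurable slices, rotated `c`-DSS with an ARBITRARY twist `R ∈ O(3)`
(`IsRotatedDSS c R u`, `1 < c`) and Type-I bound `HasTypeIDecay M u`. If for EVERY Type-I
representative `V` (`IsTypeIAncientMild M V`, `V t = u t` a.e. for `t < 0`) the physical-variables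
sign condition `0 ≤ ⟪x, V(t,x)⟫ (½|V(t,x)|² + Q[V(t)](x))` holds for all `t < 0`, `x` (`Q` the
Calderón–Zygmund pressure of the slice — GAUGE NAMED, the hypothesis is gauge dependent by nature),
then `u(t) = 0` a.e. for every `t < 0`. Removes the «twist about the `e₃`-axis» scope restriction of
`rdssClass_signCoherent_ae_zero`. Proof: `rdssClass_classicalRepresentative` (any `R`) +
`typeI_rdss_signCoherent_eq_zero_of_twist`.
[this file; theory T42/E33 + E33-CLASS-BRIDGE v1.2 (C4) and l.10] -/
theorem rdssClass_signCoherent_ae_zero_of_twist {M c : ℝ}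
    {R : EuclideanSpace ℝ (Fin 3) ≃ₗᵢ[ℝ] EuclideanSpace ℝ (Fin 3)}
    {u : ℝ → EuclideanSpace ℝ (Fin 3) → EuclideanSpace ℝ (Fin 3)} (hc : 1 < c)
    (hu : IsAncientMildSolution 1 u) (hmeas : ∀ t < 0, AEStronglyMeasurable (u t) volume)
    (hdss : IsRotatedDSS c R u) (hdec : HasTypeIDecay M u)
    (hsign : ∀ V : ℝ → EuclideanSpace ℝ (Fin 3) → EuclideanSpace ℝ (Fin 3),
      IsTypeIAncientMild M V → (∀ t < 0, V t =ᵐ[volume] u t) →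
      ∀ t < 0, ∀ x : EuclideanSpace ℝ (Fin 3), 0 ≤ ⟪x, V t x⟫ *
          (2⁻¹ * ‖V t x‖ ^ 2 + pressurePotential (V t) x)) :
    ∀ t < 0, u t =ᵐ[volume] 0 := by
  obtain ⟨V, P₀, hT, -, hR, hVdec, hVu, -⟩
      := rdssClass_classicalRepresentative hc hu hmeas hdss hdec
  have hz : ∀ t < 0, ∀ x, V t x = 0 :=
    typeI_rdss_signCoherent_eq_zero_of_twist hc hT hR hVdec (hsign V hT hVu)
  intro t ht
  have hVt : V t = 0 := funext fun x => by simpa using hz t ht x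
  exact (hVu t ht).symm.trans (Filter.EventuallyEq.of_eq hVt)

/-- **E33 (pointwise form): the sign-coherent cell is EMPTY at CLASS level for EVERY twist
`R ∈ O(3)`** (pattern of `rdssClass_signCoherent_empty`, with the twist quantified over all linear
isometries of `ℝ³` and the sign hypothesis in its frame-free physical-variables form, Calderón–Zygmund
gauge): for every Type-I bound `M` there is no member (`1 < c`, any `R`) all of whose Type-I
representatives satisfy `0 ≤ ⟪x, V⟫(½|V|² + Q[V(t)])` on the whole past and which is not a.e. zero.
An empty cell is a census ghost index, never a discard; conditional theorems about hypothetical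
profiles; nothing here bears on Navier–Stokes regularity. [this file; theory T42/E33 + E33-CLASS-BRIDGE l.10] -/
theorem rdssClass_signCoherent_empty_of_twist (M : ℝ) :
    ¬ ∃ (c : ℝ) (R : EuclideanSpace ℝ (Fin 3) ≃ₗᵢ[ℝ] EuclideanSpace ℝ (Fin 3))
        (u : ℝ → EuclideanSpace ℝ (Fin 3) → EuclideanSpace ℝ (Fin 3)),
      1 < c ∧ IsAncientMildSolution 1 u ∧ (∀ t < 0, AEStronglyMeasurable (u t) volume) ∧
      IsRotatedDSS c R u ∧ HasTypeIDecay M u ∧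
      (∀ V : ℝ → EuclideanSpace ℝ (Fin 3) → EuclideanSpace ℝ (Fin 3),
        IsTypeIAncientMild M V → (∀ t < 0, V t =ᵐ[volume] u t) →
        ∀ t < 0, ∀ x : EuclideanSpace ℝ (Fin 3), 0 ≤ ⟪x, V t x⟫ *
            (2⁻¹ * ‖V t x‖ ^ 2 + pressurePotential (V t) x)) ∧
      ¬ (∀ t < 0, u t =ᵐ[volume] 0) := by
  rintro ⟨c, R, u, hc, hu, hmeas, hdss, hdec, hsign, hne⟩
  exact hne (rdssClass_signCoherent_ae_zero_of_twist hc hu hmeas hdss hdec hsign)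

/-! ### E33-MEAN for a general twist — the Gaussian radial-flux pairing in the frame-free form -/

/-- **The co-rotating frame and the conjugation drop out of the Gaussian pairing.** For the
conjugated field `W = P⁻¹ V P` and ANY frame angle `b`, the slice pairing of the `e₃`-axis theorems
(co-rotating profile `R_{−b}(lerayOrbit W s)(R_b y)`, transported Calderón–Zygmund pressure of `W`)
equals the FRAME-FREE pairing of `V`:
`∫ γ(y) ⟪y,U⟫(½|U|² + P + ½⟪y,U⟫) dy` with `U = lerayOrbit V s`, `P(y) = e^{−s}Q[V(−e^{−s})](e^{−s/2}y)`
(substitute `y ↦ P R_b y`: `γ`, the inner products and Lebesgue measure are `O(3)` invariant, and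
`Q[P⁻¹ V P] = Q[V] ∘ P`). [folklore] -/
theorem integral_gaussPairing_corot_conj
    (P : EuclideanSpace ℝ (Fin 3) ≃ₗᵢ[ℝ] EuclideanSpace ℝ (Fin 3))
    (V : ℝ → EuclideanSpace ℝ (Fin 3) → EuclideanSpace ℝ (Fin 3)) (b s : ℝ) :
    (∫ y : EuclideanSpace ℝ (Fin 3), gaussWeight y *
        (⟪y, rotZ (-b) (lerayOrbit (fun t x => P.symm (V t (P x))) s (rotZ b y))⟫ *
          (2⁻¹ * ‖rotZ (-b) (lerayOrbit (fun t x => P.symm (V t (P x))) s (rotZ b y))‖ ^ 2 +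
            Real.exp (-s) * pressurePotential (fun x => P.symm (V (-Real.exp (-s)) (P x)))
              (Real.exp (-s / 2) • rotZ b y) +
            1 / 2 * ⟪y, rotZ (-b) (lerayOrbit (fun t x => P.symm (V t (P x))) s (rotZ b y))⟫))) =
      ∫ y : EuclideanSpace ℝ (Fin 3), gaussWeight y * (⟪y, lerayOrbit V s y⟫ *
          (2⁻¹ * ‖lerayOrbit V s y‖ ^ 2 +
        Real.exp (-s) * pressurePotential (V (-Real.exp (-s))) (Real.exp (-s / 2) • y) +
        1 / 2 * ⟪y, lerayOrbit V s y⟫)) := by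
  simp only [inner_rotZ_neg, norm_rotZ, lerayOrbit_conj_symm, inner_symm_right,
    LinearIsometryEquiv.norm_map, pressurePotential_conj_symm, map_smul]
  have e : ∀ y : EuclideanSpace ℝ (Fin 3), P (rotZ b y) = ((rotZLIE b).trans P) y := fun y => rfl
  simp only [e]
  exact integral_gaussWeight_mul_comp _ (fun w => ⟪w, lerayOrbit V s w⟫ *
    (2⁻¹ * ‖lerayOrbit V s w‖ ^ 2 +
      Real.exp (-s) * pressurePotential (V (-Real.exp (-s))) (Real.exp (-s / 2) • w) +
      1 / 2 * ⟪w, lerayOrbit V s w⟫))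

/-- **The frame-free Gaussian pairing of a rotated-DSS field is `2 log c`-periodic in `s`** (KNSS
gauge, Type-I space–time bound, any twist `R ∈ O(3)`, `1 < c`): the similarity profile returns after
one period up to the twist, `lerayOrbit V (s + 2 log c) = R⁻¹ (lerayOrbit V s) R`
(`IsRotatedDSS.lerayOrbit_add_period`), the transported pressure is the potential OF THE SIMILARITY
SLICE (`exp_mul_pressurePotential_eq`), hence returns up to the same twist (`Q[R⁻¹ U R] = Q[U] ∘ R`),
and the pairing is `O(3)` invariant. [folklore] -/
theorem integral_gaussPairing_add_period {M c : ℝ}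
    {R : EuclideanSpace ℝ (Fin 3) ≃ₗᵢ[ℝ] EuclideanSpace ℝ (Fin 3)}
    {V : ℝ → EuclideanSpace ℝ (Fin 3) → EuclideanSpace ℝ (Fin 3)}
    (hc : 1 < c) (hT : IsTypeIAncientMild M V) (hR : IsRotatedDSS c R V) (hVdec : HasTypeIDecay M V)
    (s : ℝ) :
    (∫ y : EuclideanSpace ℝ (Fin 3), gaussWeight y * (⟪y, lerayOrbit V (s + 2 * Real.log c) y⟫ *
        (2⁻¹ * ‖lerayOrbit V (s + 2 * Real.log c) y‖ ^ 2 +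
          Real.exp (-(s + 2 * Real.log c)) *
            pressurePotential (V (-Real.exp (-(s + 2 * Real.log c))))
              (Real.exp (-(s + 2 * Real.log c) / 2) • y) +
          1 / 2 * ⟪y, lerayOrbit V (s + 2 * Real.log c) y⟫))) =
      ∫ y : EuclideanSpace ℝ (Fin 3), gaussWeight y * (⟪y, lerayOrbit V s y⟫ *
          (2⁻¹ * ‖lerayOrbit V s y‖ ^ 2 +
        Real.exp (-s) * pressurePotential (V (-Real.exp (-s))) (Real.exp (-s / 2) • y) +
        1 / 2 * ⟪y, lerayOrbit V s y⟫)) := by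
  have hV2 : ∀ σ : ℝ, ContDiff ℝ 2 (V (-Real.exp (-σ))) := fun σ =>
    (hT.contDiff_slice (neg_neg_of_pos (Real.exp_pos _))).of_le (by norm_cast)
  simp only [exp_mul_pressurePotential_eq hVdec (s + 2 * Real.log c) (hV2 _),
    exp_mul_pressurePotential_eq hVdec s (hV2 _)]
  have hper : lerayOrbit V (s + 2 * Real.log c) = fun y => R.symm (lerayOrbit V s (R y)) :=
    funext fun y => hR.lerayOrbit_add_period (by linarith) s y
  rw [hper]
  simp only [inner_symm_right, LinearIsometryEquiv.norm_map, pressurePotential_conj_symm]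
  exact integral_gaussWeight_mul_comp R (fun w => ⟪w, lerayOrbit V s w⟫ *
    (2⁻¹ * ‖lerayOrbit V s w‖ ^ 2 + pressurePotential (lerayOrbit V s) w +
      1 / 2 * ⟪w, lerayOrbit V s w⟫))

/-- **Two periods from one.** If `J` is `S`-periodic (`0 ≤ S`) and `0 ≤ ∫₀^S J`, then
`0 ≤ ∫₀^{2S} J`: for `J` integrable on `[0, S]` the integral over `[0, 2S]` is twice that over one
period; otherwise neither integral exists and both are Lean's junk value `0`. [folklore] -/
theorem intervalIntegral_nonneg_two_periods {J : ℝ → ℝ} {S : ℝ} (hS : 0 ≤ S)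
    (hper : ∀ s, J (s + S) = J s) (h : 0 ≤ ∫ s in (0 : ℝ)..S, J s) :
    0 ≤ ∫ s in (0 : ℝ)..(2 * S), J s := by
  by_cases hI : IntervalIntegrable J volume 0 S
  · have hI2 : IntervalIntegrable J volume S (2 * S) := by
      have h1 := hI.comp_sub_right S
      have e : (fun x => J (x - S)) = J := funext fun x => by rw [← hper (x - S), sub_add_cancel]
      rw [e, zero_add, ← two_mul] at h1
      exact h1
    have hshift : ∫ s in S..(2 * S), J s = ∫ s in (0 : ℝ)..S, J s := by
      have h2 := intervalIntegral.integral_comp_add_right J S (a := 0) (b := S)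
      rw [zero_add, ← two_mul] at h2
      rw [← h2]
      exact intervalIntegral.integral_congr fun x _ => hper x
    rw [← intervalIntegral.integral_add_adjacent_intervals hI hI2, hshift]
    linarith
  · have hI2 : ¬ IntervalIntegrable J volume 0 (2 * S) := fun h2 =>
      hI (h2.mono_set (Set.uIcc_subset_uIcc Set.left_mem_uIcc
        (Set.mem_uIcc.2 (Or.inl ⟨hS, by linarith⟩))))
    rw [intervalIntegral.integral_undef hI2]

/-- **E33-MEAN, CLASSICAL level, GENERAL TWIST `R ∈ O(3)`, ONE PERIOD.** Let `V` be a Type-I ancient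
mild field in the KNSS gauge with the space–time Type-I bound, rotated `c`-DSS with an ARBITRARY
twist `R` (any linear isometry of `ℝ³`, `1 < c`). The hypothesis is the single inequality
`0 ≤ ∫₀^{2 log c} ∫ γ(y) ⟪y, U⟫ (½|U|² + P + ½⟪y, U⟫) dy ds` for the FRAME-FREE similarity profile
`U = lerayOrbit V s` and the transported Calderón–Zygmund pressure `P(y,s) = e^{−s}Q[V(−e^{−s})](e^{−s/2}y)`
(`γ = gaussWeight`; this period mean is gauge invariant and, for the `e₃`-axis twist, is literally the
hypothesis of `typeI_rdss_meanSignCoherent_eq_zero`: the co-rotating frame rotation drops out of the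
Gaussian pairing slice by slice, `integral_gaussPairing_corot_conj`). Then `V ≡ 0` on `t < 0`.
PROOF (bookkeeping only): pass to `(c², R²)` (`isRotatedDSS_mul`), put `R² = P R_θ P⁻¹` (Euler's
rotation theorem, `TwistNormalForm.exists_trans_self_eq_conj_rotZLIE`), conjugate to the `e₃`-axis
E33-MEAN theorem at factor `c²`, whose two-period hypothesis `0 ≤ ∫₀^{4 log c}` follows from the
one-period one because the frame-free pairing is `2 log c`-periodic (`integral_gaussPairing_add_period`,
`intervalIntegral_nonneg_two_periods`).
[this file; theory T42/E33, NULL-TESTS n21 (E33-MEAN) + E33-CLASS-BRIDGE l.10, classical level] -/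
theorem typeI_rdss_meanSignCoherent_eq_zero_of_twist {M c : ℝ}
    {R : EuclideanSpace ℝ (Fin 3) ≃ₗᵢ[ℝ] EuclideanSpace ℝ (Fin 3)}
    {V : ℝ → EuclideanSpace ℝ (Fin 3) → EuclideanSpace ℝ (Fin 3)} (hc : 1 < c)
    (hT : IsTypeIAncientMild M V) (hR : IsRotatedDSS c R V) (hVdec : HasTypeIDecay M V)
    (hmV : 0 ≤ ∫ s in (0 : ℝ)..(2 * Real.log c), ∫ y : EuclideanSpace ℝ (Fin 3), gaussWeight y *
        (⟪y, lerayOrbit V s y⟫ * (2⁻¹ * ‖lerayOrbit V s y‖ ^ 2 +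
          Real.exp (-s) * pressurePotential (V (-Real.exp (-s))) (Real.exp (-s / 2) • y) +
          1 / 2 * ⟪y, lerayOrbit V s y⟫))) :
    ∀ t < 0, ∀ x, V t x = 0 := by
  have hR2 : IsRotatedDSS (c * c) (R * R) V := isRotatedDSS_mul hR hR
  obtain ⟨P, θ, hPθ⟩ := exists_trans_self_eq_conj_rotZLIE R
  have hcc : 1 < c * c := by nlinarith
  have hTW := isTypeIAncientMild_conj_symm hT P
  have hWdec := hasTypeIDecay_conj_symm hVdec P
  have hRW := isRotatedDSS_conj_symm_of_eq_conj hR2 hPθ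
  have hlog : 2 * Real.log (c * c) = 2 * (2 * Real.log c) := by
    rw [Real.log_mul (by positivity) (by positivity)]; ring
  have h2per : 0 ≤ ∫ s in (0 : ℝ)..(2 *
      (2 * Real.log c)), ∫ y : EuclideanSpace ℝ (Fin 3), gaussWeight y *
      (⟪y, lerayOrbit V s y⟫ * (2⁻¹ * ‖lerayOrbit V s y‖ ^ 2 +
        Real.exp (-s) * pressurePotential (V (-Real.exp (-s))) (Real.exp (-s / 2) • y) +
        1 / 2 * ⟪y, lerayOrbit V s y⟫)) :=
    intervalIntegral_nonneg_two_periods (by positivity [Real.log_pos hc])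
      (fun s => integral_gaussPairing_add_period hc hT hR hVdec s) hmV
  have hz := typeI_rdss_meanSignCoherent_eq_zero hcc hTW hRW hWdec (by
    rw [intervalIntegral.integral_congr (fun s _ => integral_gaussPairing_corot_conj P V _ s), hlog]
    exact h2per)
  intro t ht x
  have h := hz t ht (P.symm x)
  simp only [LinearIsometryEquiv.apply_symm_apply, LinearIsometryEquiv.map_eq_zero_iff] at h
  exact h

/-! ### E33-MEAN for a general twist — CLASS level -/

/-- **E33-MEAN at CLASS level, GENERAL TWIST — Liouville form.** Let `u` be an ancient mild solution
(`ν = 1`) with measurable slices, rotated `c`-DSS with an ARBITRARY twist `R ∈ O(3)` (`1 < c`) and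
Type-I bound `HasTypeIDecay M u`. If for EVERY Type-I representative `V` the frame-free period mean
`∫₀^{2 log c} ∫ γ ⟪y,U⟫(½|U|² + P + ½⟪y,U⟫)` (`U = lerayOrbit V s`, `P` the transported
Calderón–Zygmund pressure; the period mean is gauge invariant) is `≥ 0`, then `u(t) = 0` a.e. for
every `t < 0`. Removes the «twist about the `e₃`-axis» scope restriction of
`rdssClass_meanSignCoherent_ae_zero` (same cell: for the `e₃` twist the co-rotating frame drops out of
the pairing). Proof: `rdssClass_classicalRepresentative` (any `R`) +
`typeI_rdss_meanSignCoherent_eq_zero_of_twist`.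
[this file; theory T42/E33, NULL-TESTS n21 (E33-MEAN) + E33-CLASS-BRIDGE l.10] -/
theorem rdssClass_meanSignCoherent_ae_zero_of_twist {M c : ℝ}
    {R : EuclideanSpace ℝ (Fin 3) ≃ₗᵢ[ℝ] EuclideanSpace ℝ (Fin 3)}
    {u : ℝ → EuclideanSpace ℝ (Fin 3) → EuclideanSpace ℝ (Fin 3)} (hc : 1 < c)
    (hu : IsAncientMildSolution 1 u) (hmeas : ∀ t < 0, AEStronglyMeasurable (u t) volume)
    (hdss : IsRotatedDSS c R u) (hdec : HasTypeIDecay M u)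
    (hmean : ∀ V : ℝ → EuclideanSpace ℝ (Fin 3) → EuclideanSpace ℝ (Fin 3),
      IsTypeIAncientMild M V → (∀ t < 0, V t =ᵐ[volume] u t) →
      0 ≤ ∫ s in (0 : ℝ)..(2 * Real.log c), ∫ y : EuclideanSpace ℝ (Fin 3), gaussWeight y *
        (⟪y, lerayOrbit V s y⟫ * (2⁻¹ * ‖lerayOrbit V s y‖ ^ 2 +
          Real.exp (-s) * pressurePotential (V (-Real.exp (-s))) (Real.exp (-s / 2) • y) +
          1 / 2 * ⟪y, lerayOrbit V s y⟫))) :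
    ∀ t < 0, u t =ᵐ[volume] 0 := by
  obtain ⟨V, P₀, hT, -, hR, hVdec, hVu, -⟩
      := rdssClass_classicalRepresentative hc hu hmeas hdss hdec
  have hz : ∀ t < 0, ∀ x, V t x = 0 :=
    typeI_rdss_meanSignCoherent_eq_zero_of_twist hc hT hR hVdec (hmean V hT hVu)
  intro t ht
  have hVt : V t = 0 := funext fun x => by simpa using hz t ht x
  exact (hVu t ht).symm.trans (Filter.EventuallyEq.of_eq hVt)

/-- **E33-MEAN: the period-mean sign-coherent cell is EMPTY at CLASS level for EVERY twist
`R ∈ O(3)`** (pattern of `rdssClass_meanSignCoherent_empty`, twist quantified over all linear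
isometries of `ℝ³`, frame-free Gaussian radial-flux pairing over ONE period `2 log c`,
Calderón–Zygmund gauge): for every Type-I bound `M` there is no member all of whose Type-I
representatives have a non-negative period mean and which is not a.e. zero. The census's operational
ghost criterion (NULL-TESTS n21) for an arbitrary screw axis; an empty cell is a ghost index, never a
discard; conditional theorems about hypothetical profiles; nothing here bears on Navier–Stokes
regularity. [this file; theory T42/E33, NULL-TESTS n21 + E33-CLASS-BRIDGE l.10] -/
theorem rdssClass_meanSignCoherent_empty_of_twist (M : ℝ) :
    ¬ ∃ (c : ℝ) (R : EuclideanSpace ℝ (Fin 3) ≃ₗᵢ[ℝ] EuclideanSpace ℝ (Fin 3))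
        (u : ℝ → EuclideanSpace ℝ (Fin 3) → EuclideanSpace ℝ (Fin 3)),
      1 < c ∧ IsAncientMildSolution 1 u ∧ (∀ t < 0, AEStronglyMeasurable (u t) volume) ∧
      IsRotatedDSS c R u ∧ HasTypeIDecay M u ∧
      (∀ V : ℝ → EuclideanSpace ℝ (Fin 3) → EuclideanSpace ℝ (Fin 3),
        IsTypeIAncientMild M V → (∀ t < 0, V t =ᵐ[volume] u t) →
        0 ≤ ∫ s in (0 : ℝ)..(2 * Real.log c), ∫ y : EuclideanSpace ℝ (Fin 3), gaussWeight y *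
          (⟪y, lerayOrbit V s y⟫ * (2⁻¹ * ‖lerayOrbit V s y‖ ^ 2 +
            Real.exp (-s) * pressurePotential (V (-Real.exp (-s))) (Real.exp (-s / 2) • y) +
            1 / 2 * ⟪y, lerayOrbit V s y⟫))) ∧
      ¬ (∀ t < 0, u t =ᵐ[volume] 0) := by
  rintro ⟨c, R, u, hc, hu, hmeas, hdss, hdec, hmean, hne⟩
  exact hne (rdssClass_meanSignCoherent_ae_zero_of_twist hc hu hmeas hdss hdec hmean)

/-- **The `e₃`-axis E33-MEAN class theorem with the frame dropped.** For the Pineau–Vicol twist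
`rotZLIE (−θ)` the hypothesis of `rdssClass_meanSignCoherent_ae_zero` (co-rotating frame `R_{αs}`,
`α = θ/(2 log c)`) and the frame-free hypothesis of `rdssClass_meanSignCoherent_ae_zero_of_twist` are
the same number, representative by representative (`integral_gaussPairing_corot_conj`, `P = 1`). [this file] -/
theorem rdssClass_meanSignCoherent_ae_zero_frameFree {M c θ : ℝ}
    {u : ℝ → EuclideanSpace ℝ (Fin 3) → EuclideanSpace ℝ (Fin 3)} (hc : 1 < c)
    (hu : IsAncientMildSolution 1 u) (hmeas : ∀ t < 0, AEStronglyMeasurable (u t) volume)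
    (hdss : IsRotatedDSS c (rotZLIE (-θ)) u) (hdec : HasTypeIDecay M u)
    (hmean : ∀ V : ℝ → EuclideanSpace ℝ (Fin 3) → EuclideanSpace ℝ (Fin 3),
      IsTypeIAncientMild M V → (∀ t < 0, V t =ᵐ[volume] u t) →
      0 ≤ ∫ s in (0 : ℝ)..(2 * Real.log c), ∫ y : EuclideanSpace ℝ (Fin 3), gaussWeight y *
        (⟪y, lerayOrbit V s y⟫ * (2⁻¹ * ‖lerayOrbit V s y‖ ^ 2 +
          Real.exp (-s) * pressurePotential (V (-Real.exp (-s))) (Real.exp (-s / 2) • y) +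
          1 / 2 * ⟪y, lerayOrbit V s y⟫))) :
    ∀ t < 0, u t =ᵐ[volume] 0 :=
  rdssClass_meanSignCoherent_ae_zero_of_twist hc hu hmeas hdss hdec hmean

end Summit.NavierStokesRegularity.NavierStokesRegularity.Theorems.GaussianHeadPressure
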